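import Literature.AnabelianGeometry.EtaleTheta.ThetaSettingHatThetaOfCurve
import Literature.AnabelianGeometry.EtaleTheta.SettingModelChiThetaTopology
import HarnessLib

/-!
# [EtTh] §1 p. 12 / Rmk. 1.6.4: the profinite theta quotient record `ThetaSetting.HatTheta` INHABITED OUTRIGHT at the
# χ-twisted model of record `modelχ` (no binder)

S. Mochizuki, *The Étale Theta Function …* [EtTh], Publ. RIMS **45** (2009), §1, PDF p. 12 (PRIMS p. 238):
"`Π_X = (Π^tp_X)^∧`", "`Δ^Θ_X = Δ_X/[Δ_X,[Δ_X,Δ_X]]`", "`(Ẑ(1) ≅) Δ_Θ`" [cite: MochizukiEtTh2009, §1 p.12]; Rmk. 1.6.4,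
PDF p. 26 (PRIMS p. 252) [cite: MochizukiEtTh2009, Rmk 1.6.4 p.26].

Layer L2 of the abc-iut cell, seat abc-iut-f-142 gen 8, row «HATTHETA-OF-CURVE» (abc-iut-L2-lead gen 8 R1273), file C:
the NON-VACUITY of abc-iut-f-142's hypothesis record `ThetaSetting.HatTheta` (p504464) at a MODEL OF RECORD.  At the
χ-twisted model `ThetaSetting.modelχ p` (abc-iut-w5-d249 / abc-iut-L2-t1 lineage, `SettingModelChiTheta.lean`:
`Π^tp_X = (F̂₂ ×_Ẑ ℤ) ⋊_χ G_{ℚ_p}`, `Π_X = F̂₂ ⋊ G_{ℚ_p}`, theta block `GtpTheta := CurveTheta.GTheta (curveχ p)` BY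
DEFINITION) the one displayed binder «`Δ_Θ` compact» of `HatTheta.ofCurveTheta` is abc-iut-L2-t8's THEOREM
`SettingModel.isCompact_deltaTheta_modelχ` (`SettingModelChiThetaTopology.lean`), and the identification `e` is the
identity: so `hatThetaModelχ p : (ThetaSetting.modelχ p).HatTheta` with NO hypothesis — the record is INHABITED at
modelχ, its profinite theta quotient being `Π_X ⧸ [[Δ_X,Δ_X],Δ_X]⁻` of file A (`CurveTheta.GThetaHat (curveχ p)`, by `rfl`).

HONEST LABEL: modelχ is a SEMI-SYNTHETIC model (consistency evidence for OUR typed interfaces, not the tempered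
fundamental group of a curve); inhabited-at-a-model ≠ proved in print; nothing of [EtTh] Rmk. 1.6.4 is asserted; no
side is taken on [IUTchIII] Cor. 3.12; nothing here asserts that abc is proved or refuted.  Class (b) (one `def`
= the instance), no `instance` keyword, no notation, no `Prop`-fact.
-/

noncomputable section

namespace Literature.AnabelianGeometry.EtaleTheta

open Literature.AnabelianGeometry.SemiGraphs SettingModel

variable (p : ℕ) [Fact p.Prime]

namespace ThetaSetting

/-- **The profinite theta quotient record at `modelχ`, NO binder**: `HatTheta.ofCurveTheta` at the χ-twisted model with
`e := ContinuousMulEquiv.refl`, `he := rfl` (the model's theta block IS `CurveTheta`'s) and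
`hΔ := SettingModel.isCompact_deltaTheta_modelχ p` (abc-iut-L2-t8).  [cite: MochizukiEtTh2009, §1 p.12] -/
def hatThetaModelχ : (ThetaSetting.modelχ p).HatTheta :=
  HatTheta.ofCurveTheta (ThetaSetting.modelχ p) (ContinuousMulEquiv.refl _) (fun _ => rfl)
    (isCompact_deltaTheta_modelχ p)

/-- Its profinite theta quotient is file A's `Π_X ⧸ [[Δ_X,Δ_X],Δ_X]⁻` over `curveχ p` (by `rfl`).
[cite: MochizukiEtTh2009, §1 p.12] -/
theorem hatThetaModelχ_ghatTheta :
    (hatThetaModelχ p).GhatTheta = CurveTheta.GThetaHat (SettingModel.curveχ p) := rfl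

/-- Its `ι` is file A's `CurveTheta.ιTheta (curveχ p)` (pointwise, by `rfl`). [cite: MochizukiEtTh2009, §1 p.12] -/
theorem hatThetaModelχ_ι_apply (x : (ThetaSetting.modelχ p).GtpTheta) :
    (hatThetaModelχ p).ι x = CurveTheta.ιTheta (SettingModel.curveχ p) x := rfl

/-- **Non-vacuity of the record `ThetaSetting.HatTheta` at a model of record:** `Nonempty (modelχ p).HatTheta`.
[cite: MochizukiEtTh2009, Rmk 1.6.4 p.26] -/
theorem nonempty_hatTheta_modelχ : Nonempty (ThetaSetting.modelχ p).HatTheta := ⟨hatThetaModelχ p⟩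

end ThetaSetting

end Literature.AnabelianGeometry.EtaleTheta

end
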